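import Summits.ValiantsHypothesis.ValiantsHypothesis.Theorems.KPlusLogSqLawTropicalSymmetricThreeFour

/-!
# Route «KPlusLogSqLaw» — the SYMMETRIC `m = 3` tropical row is NEVER slope-count-extremal: `T_sym(3,K) ≤ C(K+2,3) − 2` for every `K ≥ 4`

HONEST FRAMING.  Helper file (seat val-sym-lift-p2 (g4), cell `pub-symmetroid`, 2026-08-26; `--supports` the `WeakLifting` item
stmt-ValiantsHypothesis-19561 as a helper, no closure claim).  SMALL-FORMAT, ORDER-LEVEL statement in the single-term-carrier model (an explicit
`IsDominant` chain, exactly like `tropRow_two_symm_le` / `tropRow_three_four_symm_le`); nothing on `TropicalB` / `WeakLifting` in their windows,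
Conjecture B, the Door-A registers, `MatrixDescartes` (stmt-ValiantsHypothesis-18050) or VP ≠ VNP.

STATEMENT (`tropRow_three_symm_le`): for every `K ≥ 4`, exponents `d : Fin K → ℕ` (any support), SYMMETRIC valuations and signs on `3 × 3`, and a
chain of `n + 1` uniquely dominant terms at strictly increasing integer slopes with alternating signs, `n + 2 ≤ multichoose K 3 = C(K+2, 3)`, i.e.
a symmetric `3 × 3` design never realises all `C(K+2,3)` class multisets (the slope-counting ceiling `TropicalCensus.tropRootLawAt_slopeCount` is
missed by at least one).  At `K = 4` this is the tree's `tropRow_three_four_symm_le` (`≤ 18`); at `K = 5, 6` the bound (`≤ 33`, `≤ 54`) is below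
the general kernel ceiling `18K − 53` of `tropRootLawAt_three_sharp` (`37`, `55`) for symmetric designs; from `K = 7` on the latter is smaller.

PROOF.  Verbatim the order-level core of `…TropicalSymmetricThreeFour` (`SymmetricThreeFour.core`), with classes in `Fin K` and the eight target
multisets transported along `Fin.castLE : Fin 4 → Fin K` (ranks `0 … 3` exist as soon as `K ≥ 4`): if all multisets occurred, the distinct-class
targets `{0,1,2}, {0,1,3}, {0,2,3}, {1,2,3}` are identity-served, so the equal-sum targets `{j, j, 3 − j}` are transposition-served with pair
class `j` and fixed class `3 − j`; two of the four share a transposition and are entrywise comparable — but `j` rises exactly when `3 − j`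
falls.  The tropical input (`isDominant_symm_involutive`, `d_lt_of_dominant`, `slope_lt_of_dominant`, `stub_dominantInjective`, rank
relabelling by `dRank`) is unchanged.  [cell statement; folklore-level counting proof, no citation exists]
-/

set_option linter.dupNamespace false
set_option autoImplicit false

namespace Summit.ValiantsHypothesis.ValiantsHypothesis.Theorems.KPlusLogSqLaw

open Summit.ValiantsHypothesis.ValiantsHypothesis.Theorems.MatrixDescartes.Negative
open Summit.ValiantsHypothesis.ValiantsHypothesis.Theorems.LacunarySymmetroidMatrixDescartes
open Summit.ValiantsHypothesis.ValiantsHypothesis.Theorems.LacunarySymmetroidMatrixDescartes.TropicalCensus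
open Finset

namespace SymmetricThreeRow

open SymmetricThreeFour

variable {K : ℕ}

/-! ## 1. Cycle-constant terms of `S₃ × (Fin 3 → Fin K)` read off their class counts (as in `SymmetricThreeFour`, classes in `Fin K`) -/

/-- two entries with the same class give that class a count `≥ 2`. -/
theorem two_le_card_filter (q : Equiv.Perm (Fin 3) × (Fin 3 → Fin K)) {i j : Fin 3} (hij : j ≠ i)
    (h : q.2 j = q.2 i) : 2 ≤ (univ.filter fun x => q.2 x = q.2 i).card := by
  have hsub : ({j, i} : Finset (Fin 3)) ⊆ univ.filter fun x => q.2 x = q.2 i := by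
    intro x hx
    rw [mem_insert, mem_singleton] at hx
    rw [mem_filter]
    rcases hx with rfl | rfl
    · exact ⟨mem_univ _, h⟩
    · exact ⟨mem_univ _, rfl⟩
  calc 2 = ({j, i} : Finset (Fin 3)).card := (card_pair hij).symm
    _ ≤ _ := card_le_card hsub

/-- a cycle-constant term (`λ ∘ σ = λ`) whose classes have counts `≤ 1` is an identity term. [folklore] -/
theorem perm_eq_one_of_card_le_one (q : Equiv.Perm (Fin 3) × (Fin 3 → Fin K))
    (hc : ∀ i, q.2 (q.1 i) = q.2 i) (hle : ∀ l, (univ.filter fun i => q.2 i = l).card ≤ 1) : q.1 = 1 := by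
  by_contra hne
  obtain ⟨i, hi⟩ : ∃ i, q.1 i ≠ i := not_forall.mp fun h => hne (Equiv.ext h)
  have h2 := two_le_card_filter q hi (hc i)
  have h1 := hle (q.2 i)
  omega

/-- a cycle-constant NON-identity term with class count `1` at `b` and `≤ 1` away from `a`: the moved entries carry `a`, every fixed entry
carries `b`, and a fixed entry exists. [folklore] -/
theorem transposition_served (q : Equiv.Perm (Fin 3) × (Fin 3 → Fin K)) (a b : Fin K)
    (hc : ∀ i, q.2 (q.1 i) = q.2 i) (hne : q.1 ≠ 1)
    (hb : (univ.filter fun i => q.2 i = b).card = 1)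
    (hle : ∀ l, l ≠ a → (univ.filter fun i => q.2 i = l).card ≤ 1) :
    (∀ i, q.1 i ≠ i → q.2 i = a) ∧ (∀ k, q.1 k = k → q.2 k = b) ∧ (∃ k, q.1 k = k) := by
  have hmoved : ∀ i, q.1 i ≠ i → q.2 i = a := by
    intro i hi
    by_contra hia
    have h2 := two_le_card_filter q hi (hc i)
    have h1 := hle (q.2 i) hia
    omega
  obtain ⟨i₀, hi₀⟩ : ∃ i, q.1 i ≠ i := not_forall.mp fun h => hne (Equiv.ext h)
  obtain ⟨k, hk⟩ : ∃ k, q.2 k = b := by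
    have hpos : 0 < (univ.filter fun i => q.2 i = b).card := by rw [hb]; exact Nat.one_pos
    obtain ⟨k, hk⟩ := card_pos.mp hpos
    exact ⟨k, (mem_filter.mp hk).2⟩
  have hab : a ≠ b := by
    intro hab
    have h2 := two_le_card_filter q hi₀ (hc i₀)
    rw [hmoved i₀ hi₀, hab, hb] at h2
    omega
  have hkfix : q.1 k = k := by
    by_contra h
    exact hab ((hmoved k h).symm.trans hk)
  refine ⟨hmoved, fun k' hk' => ?_, ⟨k, hkfix⟩⟩
  have h1 : k' ≠ i₀ := by
    rintro rfl
    exact hi₀ hk'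
  have h2 : k' ≠ q.1 i₀ := by
    intro h
    apply h1
    exact q.1.injective (hk'.trans h)
  have h3 : k ≠ i₀ := by
    rintro rfl
    exact hi₀ hkfix
  have h4 : k ≠ q.1 i₀ := by
    intro h
    apply h3
    exact q.1.injective (hkfix.trans h)
  rw [fin3_third i₀ (q.1 i₀) k' k hi₀ h1 h2 h3 h4]
  exact hk

/-- entrywise comparable class vectors with equal class sums are equal. -/
theorem eq_of_le_of_sum_eq (u w : Fin 3 → Fin K) (hle : ∀ i, u i ≤ w i)
    (hs : ∑ i, (u i : ℕ) = ∑ i, (w i : ℕ)) : u = w := by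
  have hle' : ∀ i ∈ (univ : Finset (Fin 3)), (u i : ℕ) ≤ (w i : ℕ) := fun i _ => Fin.le_iff_val_le_val.mp (hle i)
  have h := (Finset.sum_eq_sum_iff_of_le hle').mp hs
  funext i
  exact Fin.ext (h i (mem_univ i))

/-! ## 2. The eight targets on the ranks `0 … 3`, transported along `Fin.castLE : Fin 4 → Fin K` -/

/-- counts transport along the embedding `Fin.castLE` (classes in its range). -/
theorem card_filter_castLE_eq (hK : 4 ≤ K) (g : Fin 3 → Fin 4) (a : Fin 4) :
    (univ.filter fun i => Fin.castLE hK (g i) = Fin.castLE hK a).card = (univ.filter fun i => g i = a).card := by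
  congr 1
  ext i
  simp only [mem_filter, mem_univ, true_and]
  exact (Fin.castLE_injective hK).eq_iff

/-- counts transport along `Fin.castLE` (classes outside its range have count `0`). -/
theorem card_filter_castLE_zero (hK : 4 ≤ K) (g : Fin 3 → Fin 4) (l : Fin K) (hl : ∀ a, Fin.castLE hK a ≠ l) :
    (univ.filter fun i => Fin.castLE hK (g i) = l).card = 0 := by
  rw [Finset.card_eq_zero, Finset.filter_eq_empty_iff]
  exact fun i _ => hl (g i)

/-- the transposition-type pattern `(3 − j, j, j)` as a vector: pair class count. -/
theorem trVec_card_a : ∀ j : Fin 4, (univ.filter fun i : Fin 3 => (![Fin.rev j, j, j] : Fin 3 → Fin 4) i = j).card = 2 := by decide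

/-- the transposition-type pattern `(3 − j, j, j)`: fixed class count. -/
theorem trVec_card_b : ∀ j : Fin 4,
    (univ.filter fun i : Fin 3 => (![Fin.rev j, j, j] : Fin 3 → Fin 4) i = Fin.rev j).card = 1 := by decide

/-- the transposition-type pattern `(3 − j, j, j)`: counts away from the pair class. -/
theorem trVec_card_le : ∀ j l : Fin 4, l ≠ j →
    (univ.filter fun i : Fin 3 => (![Fin.rev j, j, j] : Fin 3 → Fin 4) i = l).card ≤ 1 := by decide

/-- the transposition-type pattern `(3 − j, j, j)`: class sum. -/
theorem sum_trVec : ∀ j : Fin 4, ∑ i : Fin 3, ((![Fin.rev j, j, j] : Fin 3 → Fin 4) i : ℕ) = j + 3 := by decide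

/-- identity-type target in `Fin K`: counts `≤ 1`. -/
theorem idT_card_le (hK : 4 ≤ K) (j : Fin 4) (l : Fin K) :
    (univ.filter fun i : Fin 3 => Fin.castLE hK (Fin.succAbove (Fin.rev j) i) = l).card ≤ 1 := by
  by_cases hl : ∃ a, Fin.castLE hK a = l
  · obtain ⟨a, rfl⟩ := hl
    rw [card_filter_castLE_eq hK (Fin.succAbove (Fin.rev j)) a]
    exact idPat_card_le j a
  · rw [card_filter_castLE_zero hK (Fin.succAbove (Fin.rev j)) l (not_exists.mp hl)]
    exact Nat.zero_le _

/-- transposition-type target in `Fin K`: pair class count `2`. -/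
theorem trT_card_a (hK : 4 ≤ K) (j : Fin 4) :
    (univ.filter fun i : Fin 3 => Fin.castLE hK ((![Fin.rev j, j, j] : Fin 3 → Fin 4) i) = Fin.castLE hK j).card = 2 := by
  rw [card_filter_castLE_eq hK (![Fin.rev j, j, j]) j]
  exact trVec_card_a j

/-- transposition-type target in `Fin K`: fixed class count `1`. -/
theorem trT_card_b (hK : 4 ≤ K) (j : Fin 4) :
    (univ.filter fun i : Fin 3 => Fin.castLE hK ((![Fin.rev j, j, j] : Fin 3 → Fin 4) i) = Fin.castLE hK (Fin.rev j)).card = 1 := by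
  rw [card_filter_castLE_eq hK (![Fin.rev j, j, j]) (Fin.rev j)]
  exact trVec_card_b j

/-- transposition-type target in `Fin K`: counts `≤ 1` away from the pair class. -/
theorem trT_card_le (hK : 4 ≤ K) (j : Fin 4) (l : Fin K) (hl : l ≠ Fin.castLE hK j) :
    (univ.filter fun i : Fin 3 => Fin.castLE hK ((![Fin.rev j, j, j] : Fin 3 → Fin 4) i) = l).card ≤ 1 := by
  by_cases hl' : ∃ a, Fin.castLE hK a = l
  · obtain ⟨a, rfl⟩ := hl'
    rw [card_filter_castLE_eq hK (![Fin.rev j, j, j]) a]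
    exact trVec_card_le j a fun h => hl (by rw [h])
  · rw [card_filter_castLE_zero hK (![Fin.rev j, j, j]) l (not_exists.mp hl')]
    exact Nat.zero_le _

/-- identity-type target in `Fin K`: class sum `j + 3`. -/
theorem sum_idT (hK : 4 ≤ K) (j : Fin 4) :
    ∑ i : Fin 3, ((Fin.castLE hK (Fin.succAbove (Fin.rev j) i) : Fin K) : ℕ) = j + 3 := by
  simp only [Fin.val_castLE]
  exact sum_idPat j

/-- transposition-type target in `Fin K`: class sum `j + 3`. -/
theorem sum_trT (hK : 4 ≤ K) (j : Fin 4) :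
    ∑ i : Fin 3, ((Fin.castLE hK ((![Fin.rev j, j, j] : Fin 3 → Fin 4) i) : Fin K) : ℕ) = j + 3 := by
  simp only [Fin.val_castLE]
  exact sum_trVec j

/-! ## 3. The order-level core for every `K ≥ 4` -/

/-- **ORDER-LEVEL CORE, all `K ≥ 4`.**  Terms `r₀, …, r_n` of `S₃ × (Fin 3 → Fin K)` with cycle-constant class maps, same-permutation terms
entrywise non-decreasing along the sequence, class multisets pairwise distinct ⇒ `n + 2 ≤ multichoose K 3` (the `C(K+2,3)` multisets cannot all
occur). [cell statement; counting] -/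
theorem core (hK : 4 ≤ K) (n : ℕ) (r : Fin (n + 1) → Equiv.Perm (Fin 3) × (Fin 3 → Fin K))
    (h1 : ∀ k i, (r k).2 ((r k).1 i) = (r k).2 i)
    (h2 : ∀ a b : Fin (n + 1), a < b → (r a).1 = (r b).1 → ∀ i, (r a).2 i ≤ (r b).2 i)
    (h3 : Function.Injective fun k => TropicalCensus.classSym (r k)) : n + 2 ≤ Nat.multichoose K 3 := by
  have hcard := Fintype.card_le_of_injective _ h3
  rw [Fintype.card_fin, Sym.card_sym_eq_multichoose, Fintype.card_fin] at hcard
  by_contra hn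
  rw [not_le] at hn
  have heq : n + 1 = Nat.multichoose K 3 := by omega
  have hsurj : ∀ M : Sym (Fin K) 3, ∃ k : Fin (n + 1), TropicalCensus.classSym (r k) = M := by
    have hbij : Function.Bijective fun k : Fin (n + 1) => TropicalCensus.classSym (r k) := by
      rw [Fintype.bijective_iff_injective_and_card]
      refine ⟨h3, ?_⟩
      rw [Fintype.card_fin, Sym.card_sym_eq_multichoose, Fintype.card_fin, heq]
    exact fun M => hbij.2 M
  -- comparability in either order
  have hcmp : ∀ a b : Fin (n + 1), a ≠ b → (r a).1 = (r b).1 →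
      (∀ i, (r a).2 i ≤ (r b).2 i) ∨ (∀ i, (r b).2 i ≤ (r a).2 i) := by
    intro a b hab hσ
    rcases lt_trichotomy a b with h | h | h
    · exact Or.inl (h2 a b h hσ)
    · exact absurd h hab
    · exact Or.inr (h2 b a h hσ.symm)
  -- serve the eight targets (ranks `0 … 3` embedded by `Fin.castLE hK`)
  choose kI hkI using fun j : Fin 4 =>
    hsurj (TropicalCensus.classSym ((1 : Equiv.Perm (Fin 3)), fun i => Fin.castLE hK (Fin.succAbove (Fin.rev j) i)))
  choose kT hkT using fun j : Fin 4 =>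
    hsurj (TropicalCensus.classSym ((1 : Equiv.Perm (Fin 3)), fun i => Fin.castLE hK ((![Fin.rev j, j, j] : Fin 3 → Fin 4) i)))
  -- identity-type targets are served by identity terms
  have hI1 : ∀ j, (r (kI j)).1 = 1 := fun j =>
    perm_eq_one_of_card_le_one _ (h1 _) fun l => by
      rw [card_filter_eq_of_classSym_eq (hkI j) l]
      exact idT_card_le hK j l
  -- class sums
  have hsumI : ∀ j, ∑ i, ((r (kI j)).2 i : ℕ) = j + 3 := fun j => by
    rw [sum_val_eq_of_classSym_eq (hkI j)]
    exact sum_idT hK j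
  have hsumT : ∀ j, ∑ i, ((r (kT j)).2 i : ℕ) = j + 3 := fun j => by
    rw [sum_val_eq_of_classSym_eq (hkT j)]
    exact sum_trT hK j
  -- transposition-type targets are served by NON-identity terms
  have hT1 : ∀ j, (r (kT j)).1 ≠ 1 := by
    intro j hj
    have hne : kI j ≠ kT j := by
      intro h
      have hA : (univ.filter fun i => (r (kI j)).2 i = Fin.castLE hK j).card ≤ 1 := by
        rw [card_filter_eq_of_classSym_eq (hkI j)]
        exact idT_card_le hK j _
      have hB : (univ.filter fun i => (r (kT j)).2 i = Fin.castLE hK j).card = 2 := by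
        rw [card_filter_eq_of_classSym_eq (hkT j)]
        exact trT_card_a hK j
      rw [h] at hA
      omega
    have hfst : (r (kI j)).1 = (r (kT j)).1 := by rw [hI1 j, hj]
    have heqv : (r (kI j)).2 = (r (kT j)).2 := by
      rcases hcmp (kI j) (kT j) hne hfst with hle | hle
      · exact eq_of_le_of_sum_eq _ _ hle (by rw [hsumI, hsumT])
      · exact (eq_of_le_of_sum_eq _ _ hle (by rw [hsumI, hsumT])).symm
    have hrr : r (kI j) = r (kT j) := Prod.ext hfst heqv
    exact hne (h3 (by simp only [hrr]))
  -- structure of the transposition-served terms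
  have hTs : ∀ j, (∀ i, (r (kT j)).1 i ≠ i → (r (kT j)).2 i = Fin.castLE hK j) ∧
      (∀ k, (r (kT j)).1 k = k → (r (kT j)).2 k = Fin.castLE hK (Fin.rev j)) ∧ (∃ k, (r (kT j)).1 k = k) := fun j =>
    transposition_served _ (Fin.castLE hK j) (Fin.castLE hK (Fin.rev j)) (h1 _) (hT1 j)
      (by rw [card_filter_eq_of_classSym_eq (hkT j)]; exact trT_card_b hK j)
      (fun l hl => by rw [card_filter_eq_of_classSym_eq (hkT j)]; exact trT_card_le hK j l hl)
  -- pigeonhole: four transposition-served terms, three transpositions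
  have hmem : ∀ j ∈ (univ : Finset (Fin 4)), (r (kT j)).1 ∈
      ({Equiv.swap 0 1, Equiv.swap 0 2, Equiv.swap 1 2} : Finset (Equiv.Perm (Fin 3))) := by
    intro j _
    obtain ⟨-, -, k, hk⟩ := hTs j
    have := perm_three_of_fixed _ (hT1 j) ⟨k, hk⟩
    simp only [mem_insert, mem_singleton]
    exact this
  have hlt : ({Equiv.swap 0 1, Equiv.swap 0 2, Equiv.swap 1 2} : Finset (Equiv.Perm (Fin 3))).card <
      (univ : Finset (Fin 4)).card := by
    rw [card_univ, Fintype.card_fin]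
    exact lt_of_le_of_lt Finset.card_le_three (by norm_num)
  obtain ⟨j, -, j', -, hjj', hσ⟩ := Finset.exists_ne_map_eq_of_card_lt_of_maps_to hlt hmem
  have hne : kT j ≠ kT j' := by
    intro h
    have h1' := hsumT j
    rw [h, hsumT j'] at h1'
    exact hjj' (Fin.ext (by omega)).symm
  have key : ∀ x y : Fin 4, (r (kT x)).1 = (r (kT y)).1 → (∀ i, (r (kT x)).2 i ≤ (r (kT y)).2 i) → x = y := by
    intro x y hxy hle
    obtain ⟨hxa, hxb, k, hk⟩ := hTs x
    obtain ⟨hya, hyb, -⟩ := hTs y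
    obtain ⟨i₀, hi₀⟩ : ∃ i, (r (kT x)).1 i ≠ i := not_forall.mp fun h => hT1 x (Equiv.ext h)
    have ha : x ≤ y := by
      have := hle i₀
      rw [hxa i₀ hi₀, hya i₀ (by rw [← hxy]; exact hi₀)] at this
      rw [Fin.le_iff_val_le_val, Fin.val_castLE, Fin.val_castLE] at this
      exact Fin.le_iff_val_le_val.mpr this
    have hb : Fin.rev x ≤ Fin.rev y := by
      have := hle k
      rw [hxb k hk, hyb k (by rw [← hxy]; exact hk)] at this
      rw [Fin.le_iff_val_le_val, Fin.val_castLE, Fin.val_castLE] at this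
      exact Fin.le_iff_val_le_val.mpr this
    exact rev_anti x y ha hb
  rcases hcmp (kT j) (kT j') hne hσ with hle | hle
  · exact hjj' (key j j' hσ hle)
  · exact hjj' (key j' j hσ.symm hle).symm

end SymmetricThreeRow

open SymmetricThreeRow

/-- **The symmetric `m = 3` tropical row is never slope-count-extremal (`K ≥ 4`).**  A SYMMETRIC `3 × 3` dominance design with `K ≥ 4` slope
classes (symmetric valuations and signs; any exponents `d`) has at most `C(K+2,3) − 2` sign-alternating uniquely dominant breakpoints:
`n + 2 ≤ multichoose K 3`.  At `K = 4` this is `tropRow_three_four_symm_le` (`n ≤ 18`). [cell statement; folklore-level proof: the order-level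
core `SymmetricThreeRow.core` + `isDominant_symm_involutive`, `slope_lt_of_dominant`, `d_lt_of_dominant`, `stub_dominantInjective`] -/
theorem tropRow_three_symm_le (K : ℕ) (hK : 4 ≤ K) (d : Fin K → ℕ) (v ε : Fin 3 → Fin 3 → Fin K → ℤ)
    (hv : ∀ i j l, v i j l = v j i l) (hεs : ∀ i j l, ε i j l = ε j i l)
    (n : ℕ) (θ : Fin (n + 1) → ℤ) (p : Fin (n + 1) → Equiv.Perm (Fin 3) × (Fin 3 → Fin K))
    (hθ : StrictMono θ) (hdom : ∀ k, IsDominant d v ε (θ k) (p k))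
    (halt : ∀ k : Fin n, termSign ε (p k.castSucc) * termSign ε (p k.succ) < 0) : n + 2 ≤ Nat.multichoose K 3 := by
  have hinj : Function.Injective p := stub_dominantInjective 3 K d v ε n θ p hθ hdom halt
  -- rank relabelling of the classes: `ρ l = dRank d l` as an element of `Fin K`
  obtain ⟨ρ, hρ⟩ : ∃ ρ : Fin K → Fin K, ∀ l, (ρ l : ℕ) = dRank d l :=
    ⟨fun l => ⟨dRank d l, lt_of_le_of_lt (dRank_le d l) (by omega)⟩, fun _ => rfl⟩
  have hρeq : ∀ {l l' : Fin K}, ρ l = ρ l' → d l = d l' := fun {l l'} h =>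
    d_eq_of_dRank_eq d (by rw [← hρ, ← hρ, h])
  have hρle : ∀ {l l' : Fin K}, d l < d l' → ρ l ≤ ρ l' := fun {l l'} h => by
    rw [Fin.le_iff_val_le_val, hρ, hρ]
    exact (dRank_lt_of_lt d h).le
  refine core hK n (fun k => ((p k).1, fun i => ρ ((p k).2 i))) (fun k i => ?_) (fun a b hab hσ i => ?_) ?_
  · have hl := (isDominant_symm_involutive d v ε hv hεs (θ k) (p k).1 (p k).2 (hdom k)).2 i
    show ρ ((p k).2 ((p k).1 i)) = ρ ((p k).2 i)
    rw [hl]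
  · change (p a).1 = (p b).1 at hσ
    show ρ ((p a).2 i) ≤ ρ ((p b).2 i)
    by_cases h : (p a).2 i = (p b).2 i
    · rw [h]
    · have hpa : p a = ((p a).1, (p a).2) := rfl
      have hpb : p b = ((p a).1, (p b).2) := by rw [hσ]
      have hda : IsDominant d v ε (θ a) ((p a).1, (p a).2) := hpa ▸ hdom a
      have hdb : IsDominant d v ε (θ b) ((p a).1, (p b).2) := hpb ▸ hdom b
      exact hρle (d_lt_of_dominant d v ε (hθ hab) _ _ _ hda hdb i h)
  · classical
    obtain ⟨g, hg⟩ : ∃ g : Fin K → ℕ, ∀ l, g (ρ l) = d l := by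
      refine ⟨fun s => if h : ∃ l, ρ l = s then d h.choose else 0, fun l => ?_⟩
      have h : ∃ l', ρ l' = ρ l := ⟨l, rfl⟩
      dsimp only
      rw [dif_pos h]
      exact hρeq h.choose_spec
    have hslope : ∀ k, TropicalCensus.slope d (p k) = TropicalCensus.slope g ((p k).1, fun i => ρ ((p k).2 i)) := by
      intro k
      unfold TropicalCensus.slope
      simp only [hg]
    have key : ∀ a b : Fin (n + 1), a < b →
        TropicalCensus.classSym ((p a).1, fun i => ρ ((p a).2 i)) ≠
          TropicalCensus.classSym ((p b).1, fun i => ρ ((p b).2 i)) := by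
      intro a b hlt heq
      have h1 := slope_lt_of_dominant d v ε (hθ hlt) (fun e => (ne_of_lt hlt) (hinj e)) (hdom a) (hdom b)
      rw [hslope, hslope, slope_eq_of_classSym, slope_eq_of_classSym, heq] at h1
      exact lt_irrefl _ h1
    intro a b hab
    change TropicalCensus.classSym ((p a).1, fun i => ρ ((p a).2 i)) =
      TropicalCensus.classSym ((p b).1, fun i => ρ ((p b).2 i)) at hab
    rcases lt_trichotomy a b with h | h | h
    · exact absurd hab (key a b h)
    · exact h
    · exact absurd hab.symm (key b a h)

/-- binomial form: `n ≤ C(K+2, 3) − 2` for symmetric `3 × 3` designs with `K ≥ 4` classes. -/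
theorem tropRow_three_symm_le_choose (K : ℕ) (hK : 4 ≤ K) (d : Fin K → ℕ) (v ε : Fin 3 → Fin 3 → Fin K → ℤ)
    (hv : ∀ i j l, v i j l = v j i l) (hεs : ∀ i j l, ε i j l = ε j i l)
    (n : ℕ) (θ : Fin (n + 1) → ℤ) (p : Fin (n + 1) → Equiv.Perm (Fin 3) × (Fin 3 → Fin K))
    (hθ : StrictMono θ) (hdom : ∀ k, IsDominant d v ε (θ k) (p k))
    (halt : ∀ k : Fin n, termSign ε (p k.castSucc) * termSign ε (p k.succ) < 0) : n ≤ (K + 2).choose 3 - 2 := by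
  have h := tropRow_three_symm_le K hK d v ε hv hεs n θ p hθ hdom halt
  rw [Nat.multichoose_eq] at h
  have hK3 : (K + 3 - 1) = K + 2 := by omega
  rw [hK3] at h
  omega

end Summit.ValiantsHypothesis.ValiantsHypothesis.Theorems.KPlusLogSqLaw
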